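import Mathlib
import Summits.KontsevichZagierPeriods.Zeta5Search.DenomLaw.HermiteResidueSum

/-!
# ζ(5) search — DENOM-LAW D1: THEOREM M (the moment law IS the residue theorem), kernel version

Cell `pub-zeta5`, track DENOM-LAW (D1), K1 typing order item (2) «Theorem M residue identity», part 2 of 2.
HONEST FRAMING: systematic search; PURE ALGEBRA over an arbitrary field — the kernel-checked form of THEOREM M and
COROLLARY 1/2 of `denom-law/theory-d1g9/MU-LAW-PROOF.md` (denom-theory-d1 g9, answering denom-prover-d1 g4's
`denom-law/prover-d1/ATTEMPT-5.md` §4f–4g / `denom-law/DUAL-PHI-LAW.md`; checked there numerically on 190 record/flag cells).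
Nothing here is about ζ(5); no `p`-adic digit of a linear form is computed; no γ; no irrationality claim; records in
print UNMOVED.

## Content

For a finite node set `S` in a field, integer exponents `a : S → ℤ` with `a_w ≥ −2`, and a constant `c`, consider
`R(y) = c ∏_{w∈S} (y − w)^{a_w}` (track orientation: `Ḡ(y) = c ∏_{w∈S} (w − y)^{a_w}`).
* `resUnit / resLogDeriv / resMoment`: `g_z = c ∏_{w≠z} (z−w)^{a_w}`, `ψ_z = Σ_{w≠z} a_w/(z−w)` and the residue functional
  `Λ_q = Σ_{a_z = −1} q(z) g_z + Σ_{a_z = −2} g_z (q'(z) + ψ_z q(z))` (= Σ over the finite nodes of `Res (R q dy)`).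
* `resMoment_eq_zero` (**THEOREM M, product form**): `deg q + Σ_w a_w ≤ −2 ⇒ Λ_q = 0`.  Proof: with `P = ∏_{a_w ≥ 0} (X − w)^{a_w}`,
  `D = ∏_{a_w < 0} (X − w)^{−a_w}` the terms of `Λ_q` are exactly the closed-form residues of `(c q P)/D`
  (`HermiteResidueSum.nodeResidue`; simple/double poles, logarithmic derivative of `P` and of the polar cofactor), and
  `hermite_residue_sum_eq_zero` applies since `deg (c q P) ≤ deg D − 2`.
* `resMoment_eq_leadingCoeff` (**COROLLARY 1, sharpness**): in the borderline degree `deg q + Σ a = −1`, `Λ_q = c · lc(q)`.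
* The track's orientation: `unitHat` `ĝ_z = c ∏_{w≠z} (w − z)^{a_w}`, `logDerivHat` `φ_z = Σ_{w≠z} a_w/(w − z)` and the TOTAL
  MOMENT functional `moment` `μ_q = Σ_{a_z=−1} q(z) ĝ_z + Σ_{a_z=−2} ĝ_z (q(z) φ_z − q'(z))` — literally prover-d1 g4's functional
  of `ATTEMPT-5.md` §4g / `moments.py` and MU-LAW-PROOF §0 with `a = E + N₀` (there `S = 𝔽_p`, `E` = class exponents of the
  collapsed cell function, `N₀ = −E_lead − 1`, first-order classes `a = −1`, second-order classes `a = −2`);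
  `moment_eq_neg_mul`: `μ_q = −(∏_w (−1)^{a_w}) Λ_q`; `moment_eq_zero` (**the μ-LAW**): `deg q + Σ a ≤ −2 ⇒ μ_q = 0`;
  `moment_X_pow_eq_zero`: `μ_{y^k} = 0` for `k + Σ a + 2 ≤ 0` (COROLLARY 1's range `k < K`, `K = 2d + 4 − pN₀` when `S = 𝔽_p`,
  `Σ E = −(2d+5)`); `moment_eq_leadingCoeff` / `moment_X_pow_eq`: `μ_{y^K} = (−1)^K c` — the first non-vanishing moment is
  EXACTLY `K` (for `c ≠ 0`).

What is NOT here (next files of the K1 order): the dictionary from a Brown–Zudilin cell `(b, p)` to `(S, a, c)` — collapse of the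
integer nodes `s ≤ b₀` to residues mod `p`, `a = classExp + N₀` via `(y^p − y)^{N₀} = ∏_{z∈𝔽_p} (y − z)^{N₀}`, `ĝ = gHat mod p`,
`φ = foreignS1 mod p` — and the link from `μ₁, μ_r` to the leading digits of `U, W, V` (prover-d1 g4 §4f; COROLLARY 2, the
`k_c · p ≤ d` law of the record zero cells `N⁺/L⁺/H⁺`, `DenomLaw/RecordZeroCellsPlus.lean`).
-/

open Polynomial Finset

namespace Summit.KontsevichZagierPeriods.Zeta5Search.DenomLaw.MomentLaw

variable {F : Type*} [Field F] [DecidableEq F]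

/-! ### THEOREM M: products of linear factors with exponents `≥ −2` -/

section Product

variable (S : Finset F) (a : F → ℤ) (c : F)

/-- The unit `g_z = c · ∏_{w ∈ S, w ≠ z} (z − w)^{a_w}` of `R(y) = c ∏_{w∈S} (y − w)^{a_w}` at the node `z`
(`R(y) = (y − z)^{a_z} · g_z · (1 + ψ_z (y − z) + …)`). -/
noncomputable def resUnit (z : F) : F := c * ∏ w ∈ S.erase z, (z - w) ^ a w

/-- The logarithmic-derivative datum `ψ_z = Σ_{w ≠ z} a_w / (z − w)` of `R(y)/(y − z)^{a_z}` at `z`. -/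
noncomputable def resLogDeriv (z : F) : F := ∑ w ∈ S.erase z, (a w : F) / (z - w)

/-- The RESIDUE FUNCTIONAL `Λ_q = Σ_{a_z = −1} q(z) g_z + Σ_{a_z = −2} g_z (q'(z) + ψ_z q(z))` = the sum over the finite
nodes of the residues of `R(y) q(y) dy` (poles of order `≤ 2`). -/
noncomputable def resMoment (q : F[X]) : F :=
  ∑ z ∈ S with a z = -1, q.eval z * resUnit S a c z
    + ∑ z ∈ S with a z = -2, resUnit S a c z * (q.derivative.eval z + resLogDeriv S a z * q.eval z)

/-- The nodes of non-negative exponent (zeros of `R`). -/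
private noncomputable def posN : Finset F := S.filter fun w => 0 ≤ a w

/-- The nodes of negative exponent (poles of `R`). -/
private noncomputable def negN : Finset F := S.filter fun w => ¬ 0 ≤ a w

/-- The pole multiplicities `−a_w`. -/
private def mult (w : F) : ℕ := (-a w).toNat

/-- The numerator `P = ∏_{a_w ≥ 0} (X − w)^{a_w}`. -/
private noncomputable def numP : F[X] := nodePoly (posN S a) fun w => (a w).toNat

omit [DecidableEq F] in
/-- Casting `n.toNat` for `n ≥ 0`. -/
private theorem toNat_cast {n : ℤ} (hn : 0 ≤ n) : ((n.toNat : ℕ) : F) = (n : F) := by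
  rw [← Int.cast_natCast, Int.toNat_of_nonneg hn]

omit [Field F] in
/-- Removing a pole from all nodes = the zeros plus the other poles. -/
private theorem erase_split {z : F} (hz : z ∈ negN S a) :
    posN S a ∪ (negN S a).erase z = S.erase z ∧ Disjoint (posN S a) ((negN S a).erase z) := by
  unfold posN negN at *
  refine ⟨?_, ?_⟩
  · ext w
    simp only [mem_union, mem_filter, mem_erase]
    constructor
    · rintro (⟨hw, h⟩ | ⟨hne, hw, _⟩)
      · refine ⟨?_, hw⟩
        rintro rfl
        exact (mem_filter.mp hz).2 h
      · exact ⟨hne, hw⟩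
    · rintro ⟨hne, hw⟩
      by_cases h : 0 ≤ a w
      · exact Or.inl ⟨hw, h⟩
      · exact Or.inr ⟨hne, hw, h⟩
  · exact disjoint_left.mpr fun w h1 h2 => (mem_filter.mp (mem_of_mem_erase h2)).2 (mem_filter.mp h1).2

/-- The unit `g_z` at a pole is `c · P(z) / D_z(z)` (numerator over polar cofactor). -/
private theorem resUnit_eq {z : F} (hz : z ∈ negN S a) :
    resUnit S a c z = c * (numP S a).eval z / (nodePoly ((negN S a).erase z) (mult a)).eval z := by
  obtain ⟨hsplit, hdisj⟩ := erase_split S a hz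
  unfold resUnit numP
  rw [← hsplit, prod_union hdisj, eval_nodePoly, eval_nodePoly, mul_div_assoc]
  congr 1
  rw [div_eq_mul_inv, ← prod_inv_distrib]
  congr 1
  · refine prod_congr rfl fun w hw => ?_
    rw [← zpow_natCast, Int.toNat_of_nonneg (mem_filter.mp hw).2]
  · refine prod_congr rfl fun w hw => ?_
    have hw' : ¬ 0 ≤ a w := (mem_filter.mp (mem_of_mem_erase hw)).2
    rw [← zpow_natCast, ← zpow_neg, mult, Int.toNat_of_nonneg (by omega), neg_neg]

/-- The log-derivative datum `ψ_z` at a pole, split into the zero part and the polar part. -/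
private theorem resLogDeriv_eq {z : F} (hz : z ∈ negN S a) :
    resLogDeriv S a z = ∑ w ∈ posN S a, ((a w).toNat : F) / (z - w)
      - ∑ w ∈ (negN S a).erase z, (mult a w : F) / (z - w) := by
  obtain ⟨hsplit, hdisj⟩ := erase_split S a hz
  unfold resLogDeriv
  rw [← hsplit, sum_union hdisj, sub_eq_add_neg, ← sum_neg_distrib]
  congr 1
  · refine sum_congr rfl fun w hw => ?_
    rw [toNat_cast (mem_filter.mp hw).2]
  · refine sum_congr rfl fun w hw => ?_
    have hw' : ¬ 0 ≤ a w := (mem_filter.mp (mem_of_mem_erase hw)).2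
    rw [mult, toNat_cast (by omega), Int.cast_neg, neg_div, neg_neg]

/-- At a pole, the closed-form residue of `(c q P)/D` is the corresponding term of `Λ_q`. -/
private theorem nodeResidue_eq (q : F[X]) {z : F} (hz : z ∈ negN S a) (ha : -2 ≤ a z) :
    nodeResidue (negN S a) (mult a) (C c * q * numP S a) z =
      if a z = -1 then q.eval z * resUnit S a c z
      else resUnit S a c z * (q.derivative.eval z + resLogDeriv S a z * q.eval z) := by
  have hneg : ¬ 0 ≤ a z := (mem_filter.mp hz).2
  have hzP : z ∉ posN S a := fun h => hneg (mem_filter.mp h).2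
  have hP : (numP S a).eval z ≠ 0 := eval_nodePoly_ne_zero _ _ hzP
  have hD : (nodePoly ((negN S a).erase z) (mult a)).eval z ≠ 0 := eval_cofactor_ne_zero _ _ z
  unfold nodeResidue
  by_cases h1 : a z = -1
  · have hm : mult a z = 1 := by simp [mult, h1]
    rw [if_pos hm, if_pos h1, resUnit_eq S a c hz, eval_mul, eval_mul, eval_C]
    ring
  · have hm : mult a z ≠ 1 := by simp only [mult]; omega
    rw [if_neg hm, if_neg h1, resUnit_eq S a c hz, resLogDeriv_eq S a hz]
    have hP' := eval_derivative_nodePoly (posN S a) (fun w => (a w).toNat) hzP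
    have hD' := eval_derivative_nodePoly ((negN S a).erase z) (mult a) (notMem_erase z _)
    rw [derivative_mul, derivative_mul, derivative_C, zero_mul, zero_add]
    simp only [eval_add, eval_mul, eval_C]
    unfold numP at *
    rw [hP', hD']
    field_simp
    ring

omit [DecidableEq F] in
/-- Exponent bookkeeping: `Σ_w a_w = deg P − deg D` (zeros minus poles, with multiplicity). -/
private theorem sum_exponents :
    ∑ w ∈ S, a w = ((numP S a).natDegree : ℤ) - ((∑ w ∈ negN S a, mult a w : ℕ) : ℤ) := by
  have h2 : (numP S a).natDegree = ∑ w ∈ posN S a, (a w).toNat := natDegree_nodePoly _ _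
  have h3 : ∑ w ∈ posN S a, a w + ∑ w ∈ negN S a, a w = ∑ w ∈ S, a w :=
    sum_filter_add_sum_filter_not S (fun w => 0 ≤ a w) a
  have h4 : ∑ w ∈ posN S a, a w = ((∑ w ∈ posN S a, (a w).toNat : ℕ) : ℤ) := by
    rw [Nat.cast_sum]
    exact sum_congr rfl fun w hw => (Int.toNat_of_nonneg (mem_filter.mp hw).2).symm
  have h5 : ∑ w ∈ negN S a, a w = -((∑ w ∈ negN S a, mult a w : ℕ) : ℤ) := by
    rw [Nat.cast_sum, ← sum_neg_distrib]
    refine sum_congr rfl fun w hw => ?_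
    have hw' : ¬ 0 ≤ a w := (mem_filter.mp hw).2
    rw [mult, Int.toNat_of_nonneg (by omega), neg_neg]
  omega

omit [DecidableEq F] in
/-- `deg (c q P) ≤ deg q + deg P`. -/
private theorem natDegree_le (q : F[X]) : (C c * q * numP S a).natDegree ≤ q.natDegree + (numP S a).natDegree :=
  natDegree_mul_le.trans (by gcongr; exact natDegree_mul_le.trans (by simp))

omit [Field F] [DecidableEq F] in
/-- Exponents `≥ −2` means pole multiplicities `∈ {1, 2}`. -/
private theorem mult_mem (ha : ∀ w ∈ S, -2 ≤ a w) : ∀ z ∈ negN S a, mult a z = 1 ∨ mult a z = 2 := by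
  intro z hz
  have h1 : ¬ 0 ≤ a z := (mem_filter.mp hz).2
  have h2 := ha z (mem_of_mem_filter z hz)
  simp only [mult]; omega

/-- **THE DICTIONARY**: the residue functional `Λ_q` of `R = c ∏ (y − w)^{a_w}` is the Hermite residue sum of `(c q P)/D`. -/
private theorem resMoment_eq_sum (ha : ∀ w ∈ S, -2 ≤ a w) (q : F[X]) :
    resMoment S a c q = ∑ z ∈ negN S a, nodeResidue (negN S a) (mult a) (C c * q * numP S a) z := by
  rw [sum_congr rfl (fun z hz => nodeResidue_eq S a c q hz (ha z (mem_of_mem_filter z hz))), sum_ite]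
  have e1 : (negN S a).filter (fun z => a z = -1) = S.filter (fun z => a z = -1) := by
    unfold negN; rw [filter_filter]; exact filter_congr fun z _ => ⟨fun h => h.2, fun h => ⟨by omega, h⟩⟩
  have e2 : (negN S a).filter (fun z => ¬ a z = -1) = S.filter (fun z => a z = -2) := by
    unfold negN; rw [filter_filter]
    exact filter_congr fun z hz => ⟨fun h => by have := ha z hz; omega, fun h => ⟨by omega, by omega⟩⟩
  rw [e1, e2]
  rfl

/-- **THEOREM M (product form; MU-LAW-PROOF Thm M + Cor. 1/2, theory-d1 g9).**  For `R(y) = c ∏_{w∈S} (y − w)^{a_w}` with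
integer exponents `a_w ≥ −2` and a polynomial `q` with `deg q + Σ_w a_w ≤ −2`, the sum of the residues of `R q` at the finite
nodes — the functional `Λ_q = Σ_{a_z=−1} q(z) g_z + Σ_{a_z=−2} g_z (q'(z) + ψ_z q(z))` — VANISHES. -/
theorem resMoment_eq_zero (ha : ∀ w ∈ S, -2 ≤ a w) (q : F[X]) (hq : (q.natDegree : ℤ) + ∑ w ∈ S, a w ≤ -2) :
    resMoment S a c q = 0 := by
  rw [resMoment_eq_sum S a c ha]
  have h1 := natDegree_le S a c q
  have h2 := sum_exponents S a
  exact hermite_residue_sum_eq_zero (negN S a) (mult a) (C c * q * numP S a) (mult_mem S a ha) (by omega)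

/-- **COROLLARY 1, SHARPNESS (the first non-vanishing moment; MU-LAW-PROOF Cor. 1).**  In the borderline degree
`deg q + Σ_w a_w = −1` the residue functional is the leading coefficient: `Λ_q = c · lc(q)`; in particular
`Λ_{y^K} = c ≠ 0` at `K = −Σ_w a_w − 1`, one past the vanishing range. -/
theorem resMoment_eq_leadingCoeff (ha : ∀ w ∈ S, -2 ≤ a w) (q : F[X]) (hq : (q.natDegree : ℤ) + ∑ w ∈ S, a w = -1) :
    resMoment S a c q = c * q.leadingCoeff := by
  rw [resMoment_eq_sum S a c ha]
  have h1 := natDegree_le S a c q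
  have h2 := sum_exponents S a
  have hA : (C c * q * numP S a).degree < (∑ w ∈ negN S a, mult a w : ℕ) :=
    degree_le_natDegree.trans_lt (by exact_mod_cast (by omega : (C c * q * numP S a).natDegree < _))
  rw [hermite_residue_sum (negN S a) (mult a) (C c * q * numP S a) (mult_mem S a ha) hA,
    show ∑ w ∈ negN S a, mult a w - 1 = q.natDegree + (numP S a).natDegree by omega, mul_assoc, coeff_C_mul,
    coeff_mul_degree_add_degree]
  unfold numP
  rw [(nodePoly_monic _ _).leadingCoeff, mul_one]

/-! ### The same in the orientation `(w − z)` of the track's class data (`ĝ`, `φ`, `μ`) -/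

/-- The FOREIGN UNIT `ĝ_z = c · ∏_{w ∈ S, w ≠ z} (w − z)^{a_w}` of `Ḡ(y) = c ∏_{w∈S} (w − y)^{a_w}` at the node `z`
(the shape of the mod-`p` collapse of the track's `gHat`: `Ḡ(z + u) = (−u)^{a_z} ĝ_z (1 − φ_z u + O(u²))`). -/
noncomputable def unitHat (z : F) : F := c * ∏ w ∈ S.erase z, (w - z) ^ a w

/-- The LOG-DERIVATIVE datum `φ_z = Σ_{w ≠ z} a_w / (w − z)` (the shape of the mod-`p` collapse of the track's `foreignS1`). -/
noncomputable def logDerivHat (z : F) : F := ∑ w ∈ S.erase z, (a w : F) / (w - z)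

/-- The TOTAL MOMENT functional `μ_q = Σ_{a_z = −1} q(z) ĝ_z + Σ_{a_z = −2} ĝ_z (q(z) φ_z − q'(z))` of prover-d1 g4
(`ATTEMPT-5.md` §4g, `moments.py`) / MU-LAW-PROOF §0, for the exponent datum `a` (there `a = E + N₀`). -/
noncomputable def moment (q : F[X]) : F :=
  ∑ z ∈ S with a z = -1, q.eval z * unitHat S a c z
    + ∑ z ∈ S with a z = -2, unitHat S a c z * (q.eval z * logDerivHat S a z - q.derivative.eval z)

/-- Orientation change for the unit: `(−1)^{a_z} ĝ_z = (∏_{w∈S} (−1)^{a_w}) · g_z`. -/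
theorem unitHat_eq {z : F} (hz : z ∈ S) :
    (-1 : F) ^ a z * unitHat S a c z = (∏ w ∈ S, (-1 : F) ^ a w) * resUnit S a c z := by
  unfold unitHat resUnit
  rw [← mul_prod_erase S (fun w => (-1 : F) ^ a w) hz]
  have : ∏ w ∈ S.erase z, (w - z) ^ a w = (∏ w ∈ S.erase z, (-1 : F) ^ a w) * ∏ w ∈ S.erase z, (z - w) ^ a w := by
    rw [← prod_mul_distrib]
    refine prod_congr rfl fun w _ => ?_
    rw [← mul_zpow, neg_one_mul, neg_sub]
  rw [this]
  ring

/-- Orientation change for the log-derivative datum: `φ_z = −ψ_z`. -/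
theorem logDerivHat_eq (z : F) : logDerivHat S a z = -resLogDeriv S a z := by
  unfold logDerivHat resLogDeriv
  rw [← sum_neg_distrib]
  refine sum_congr rfl fun w _ => ?_
  rw [← neg_sub z w, div_neg]

/-- `μ_q = −(∏_{w∈S} (−1)^{a_w}) · Λ_q`. -/
theorem moment_eq_neg_mul (q : F[X]) :
    moment S a c q = -(∏ w ∈ S, (-1 : F) ^ a w) * resMoment S a c q := by
  have h1 : ∀ z ∈ S.filter (fun z => a z = -1),
      unitHat S a c z = -(∏ w ∈ S, (-1 : F) ^ a w) * resUnit S a c z := by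
    intro z hz
    obtain ⟨hzS, haz⟩ := mem_filter.mp hz
    have h := unitHat_eq S a c hzS
    have e : (-1 : F) ^ a z = -1 := by rw [haz]; norm_num
    rw [e] at h
    linear_combination -h
  have h2 : ∀ z ∈ S.filter (fun z => a z = -2),
      unitHat S a c z = (∏ w ∈ S, (-1 : F) ^ a w) * resUnit S a c z := by
    intro z hz
    obtain ⟨hzS, haz⟩ := mem_filter.mp hz
    have h := unitHat_eq S a c hzS
    have e : (-1 : F) ^ a z = 1 := by rw [haz]; norm_num
    rwa [e, one_mul] at h
  unfold moment resMoment
  rw [mul_add, mul_sum, mul_sum]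
  congr 1
  · refine sum_congr rfl fun z hz => ?_
    rw [h1 z hz]
    ring
  · refine sum_congr rfl fun z hz => ?_
    rw [h2 z hz, logDerivHat_eq]
    ring

/-- **THEOREM M in the track's orientation (the μ-LAW).**  For exponents `a_w ≥ −2` on the finite node set `S` and
`deg q + Σ_w a_w ≤ −2`: `μ_q = 0`. -/
theorem moment_eq_zero (ha : ∀ w ∈ S, -2 ≤ a w) (q : F[X]) (hq : (q.natDegree : ℤ) + ∑ w ∈ S, a w ≤ -2) :
    moment S a c q = 0 := by
  rw [moment_eq_neg_mul, resMoment_eq_zero S a c ha q hq, mul_zero]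

/-- **COROLLARY 1 (vanishing range of the monomial moments).**  `μ_{y^k} = 0` whenever `k + Σ_w a_w + 2 ≤ 0`, i.e. for all
`k < K := −Σ_w a_w − 2 + 1`; with `S = 𝔽_p`, `a = E + N₀` this is `K = 2d + 4 − p N₀` of MU-LAW-PROOF Cor. 1
(`Σ E = −(2d+5)`, `Σ N₀ = p N₀`). -/
theorem moment_X_pow_eq_zero (ha : ∀ w ∈ S, -2 ≤ a w) (k : ℕ) (hk : (k : ℤ) + ∑ w ∈ S, a w ≤ -2) :
    moment S a c (X ^ k) = 0 :=
  moment_eq_zero S a c ha _ (by rwa [natDegree_X_pow])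

/-- `∏_w (−1)^{a_w} = (−1)^{Σ_w a_w}`. -/
private theorem prod_neg_one_zpow : ∏ w ∈ S, (-1 : F) ^ a w = (-1 : F) ^ ∑ w ∈ S, a w := by
  induction S using Finset.induction_on with
  | empty => simp
  | insert w T hw ih => rw [prod_insert hw, sum_insert hw, ih, zpow_add₀ (by norm_num)]

/-- **COROLLARY 1, SHARPNESS, in the track's orientation.**  In the borderline degree `deg q + Σ_w a_w = −1`:
`μ_q = (−1)^{deg q} · c · lc(q)`; in particular the first moment outside the vanishing range is
`μ_{y^K} = (−1)^K c ≠ 0` (`c ≠ 0`), so the vanishing index of COROLLARY 1 is EXACTLY `K`. -/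
theorem moment_eq_leadingCoeff (ha : ∀ w ∈ S, -2 ≤ a w) (q : F[X]) (hq : (q.natDegree : ℤ) + ∑ w ∈ S, a w = -1) :
    moment S a c q = (-1 : F) ^ q.natDegree * c * q.leadingCoeff := by
  rw [moment_eq_neg_mul, resMoment_eq_leadingCoeff S a c ha q hq, prod_neg_one_zpow,
    show ∑ w ∈ S, a w = -1 - (q.natDegree : ℤ) by omega]
  rcases Nat.even_or_odd q.natDegree with he | ho
  · have : Odd (-1 - (q.natDegree : ℤ)) := by
      rcases he with ⟨r, hr⟩; exact ⟨-1 - r, by omega⟩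
    rw [this.neg_one_zpow, he.neg_one_pow]
    ring
  · have : Even (-1 - (q.natDegree : ℤ)) := by
      rcases ho with ⟨r, hr⟩; exact ⟨-1 - r, by omega⟩
    rw [this.neg_one_zpow, ho.neg_one_pow]
    ring

/-- The `K`-th monomial moment, one past the vanishing range, is `(−1)^K c`. -/
theorem moment_X_pow_eq (ha : ∀ w ∈ S, -2 ≤ a w) (K : ℕ) (hK : (K : ℤ) + ∑ w ∈ S, a w = -1) :
    moment S a c (X ^ K) = (-1 : F) ^ K * c := by
  rw [moment_eq_leadingCoeff S a c ha _ (by rwa [natDegree_X_pow]), natDegree_X_pow, leadingCoeff_X_pow, mul_one]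

end Product

end Summit.KontsevichZagierPeriods.Zeta5Search.DenomLaw.MomentLaw
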